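/-
Copyright (c) 2026 the pub-hodgecm-mathlib formalisation cell (harness21).  Prover seat hodgecm-mathlib-LH4-p14 (g8) (L1 valve hand, LEAD F0P6-plan (g14)
BATCH #149 (1); K1b∕ρ desk K2Liu-p14 (g4) DESK WORDS #1–#2), Track B «K2-LIT» ∕ hLiu418 #184♮, socket #41 KIND 1, package (K1b-♮):
(P-pin) THE PIN OF THE LINE TERM — the (hol) + (pin) letters of the K1-b♮ package AT THE TOP'S FRAME.  THEOREMS ONLY.
-/
import Summits.HodgeConjecture.HodgeConjecture.Theorems.K2LiuRankOneMiddleTermWhittakerLine        -- ★ p862785 `exists_middle_cell_rankOne_eq_whittakerDelta_line` (★ p861327 ∘ T4 chain)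
import Summits.HodgeConjecture.HodgeConjecture.Theorems.K2LiuKindOneLineWhittakerHolomorphyCorner   -- ★ p862749 `differentiableOn_whittakerDelta_cornerTranslate_line` (hol)
import Summits.HodgeConjecture.HodgeConjecture.Theorems.K2LiuLineCornerChartHaar                    -- ★ p862728 `isHaarMeasure_map_lineChart`
import Summits.HodgeConjecture.HodgeConjecture.Theorems.K2LiuUnipDeltaConjMeasurePreserving         -- ★ `measurePreserving_conj_levi` (the `hconj` letter)
import Summits.HodgeConjecture.HodgeConjecture.Theorems.K2LiuSiegelMiddleTermStabilizerWeight       -- ★ p862779 `exists_stabilizer_coveringWeight` (`Γ₀ hΓ₀ β₁ hβ₁`)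
import Summits.HodgeConjecture.HodgeConjecture.Theorems.K2LiuSiegelEisensteinConstantTermFiniteness -- ★ ed. 4a′ `lintegral_tsum_enorm_mul_weight_ne_top` (O41.4 finiteness `hH`)
import Summits.HodgeConjecture.HodgeConjecture.Theorems.K2LiuKindOneLettersOfRecord                 -- ★ p862409: the TOP's vocabulary (standard families, `toHeckeCharacter`, weights)
import Summits.HodgeConjecture.HodgeConjecture.Theorems.K2LiuRankOneMiddleTermWhittakerLineInl     -- ★ `exists_middle_cell_rankOne_eq_whittakerDelta_line_inl` (ED. 2, `e (1,0) = 0`)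
import Summits.HodgeConjecture.HodgeConjecture.Theorems.K2LiuBlockDiagSectionPullback               -- ★ p862495 `isSiegelDeltaSection_family_comp_blkD_inl`, `continuous_comp_blkD_inl` (ED. 2)
import HarnessLib

/-!
# Crux `HLiu418`, socket #41, KIND 1 — (P-pin) `K2LiuKindOneLinePin`: THE (hol) + (pin) LETTERS OF THE K1-b♮ LINE-TERM PACKAGE AT THE TOP'S FRAME

Cell `hodgecm-mathlib`, crux item hLiu418 = `stmt-HodgeConjecture-24832` (helper lane `--supports … --as helper`, count-neutral), route of record
`HCCMUnconditional`; squad K2 ∕ K2Liu, road `K2_Liu`, socket #41 `sig_K2LiuSiegelEisensteinContinuation`, KIND 1, block K1-b♮ (package writer ∕ desk K2Liu-p14 (g4),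
★-cand ED. 1 `K2LiuKindOneLineTermPackage.exists_kindOne_lineTermPackage_of_letters`; this hand LH4-p14 (g8), LEAD F0P6-plan (g14) BATCH #149 (1)).
THE MATHEMATICS [KudlaRallis1994, §2 (2.10)–(2.12)], [MoeglinWaldspurger1995, II.1.7, IV.1.9], [Tan1999, §4 Prop. 4.8], [Shimura1997, §18.4].  ★ p862785
`exists_middle_cell_rankOne_eq_whittakerDelta_line` (★ p861327 composed with the (T4) chain ★ p862584 ∕ p862629 ∕ p862662) says: for a rank-one `T_L`-skew index
`S = u ⊗ w` the middle-cell term of the `S`-th Fourier coefficient is ONE constant `C ∈ (0, ∞)` times a rank-ONE Whittaker coefficient of the doubled LINE `H(V₂)`,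
`MID_S(νN, β, f, h) = C • W⁽ᴮ⁾_{(σS'σ⁻¹)₂₂}(nB_* μ)(y ↦ f(blkD(1, y) · Λĝ[w] · h))(1)`.  THIS FILE instantiates that frame AT THE TOP's data — the standard family `f s` of
`I_Δ(s, χ)`, `χ = toHeckeCharacter L lam⁻¹` (unitary ★ `isUnitary_toHeckeCharacter`), the carrier `(νN, β ≤ 𝟙_K)` — DISCHARGING every letter that does not appear in the
line-term formula: the middle reflection `g₀` (★ `exists_reflStd`), the stabiliser lattice `Γ₀` and its covering weight `β₁` (★ p862779), the Levi Haar-invariance `hconj`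
(★ `measurePreserving_conj_levi`), O41.4's finiteness `hH` (★ ed. 4a′), and keeping BY VALUE exactly what the formula mentions (the Levi chart `Λ`, the see-saw datum
`eA eB dA dB`, the line chart `nB` and the additive Haar measure `μ`, the row section `γ`, and per index the tensor letters `u w` and the transported index `S'`), so
that the package writer's `E S s h := if S rank-one then (∫β)⁻¹ • (C • W⁽ᴮ⁾ …) else 0` and the (P-dec) ∕ (P-supp) payers all see the SAME objects:
* **`exists_pinConst_line`** (corner enumeration `e (1,0) = 1`) — ONE constant `C ≠ 0, ∞` such that for every rank-one `S` (with its by-value letters):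
  (hol) `s ↦ (∫β)⁻¹ • (C • W⁽ᴮ⁾_{S'₂₂}(nB_* μ)(y ↦ f_s(blkD(1,y) · Λĝ[w] · x))(1))` is holomorphic on the WHOLE window `{0 < re s}` for every `x` (★ p862749 at `p₀ := 1`,
  `nB_* μ` Haar ★ p862728), and (pin) on `{1 < re s}` the TOP's NORMALISED middle-cell term (the `hpin` bytes of ★-cand ED. 1 :116–:123, `n = 2`) EQUALS it (★ p862785).
* §2 (ED. 2, the `inl` enumeration `e (1,0) = 0`): **`differentiableOn_whittakerDelta_blkD_inl_line`** — the (hol) letter along the FIRST summand (`x ↦ blkD (x, 1)`,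
  ★ (KW1-a) envelope road with ★ p862495's `inl` pull-back letters), and **`exists_pinConst_line_inl`** — the token-for-token twin of `exists_pinConst_line` over
  ★ `K2LiuRankOneMiddleTermWhittakerLineInl` (line chart and Whittaker coefficient on `H(A)`, index `(σS'σ⁻¹)₁₁`, inner section `y ↦ f_s(blkD(y,1) · Λĝ · h)`).
HONEST LABEL.  Count-neutral helper, by value in `Λ γ S' u w nB μ eA eB dA dB` (all inhabited: ★ `exists_leviHom`, ★ `exists_rowSection`, ★ `exists_levi_conj_index`,
★ `exists_vecMulVec_of_det_eq_zero`, ★ p862662 `exists_lineChart`); it closes no socket by itself: `HC_CM` is proved only modulo the 7 printed citations (2 remaining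
named inputs: hLiu418 = `stmt-HodgeConjecture-24832`, h413 = `stmt-HodgeConjecture-24833`) until rung 0 closes.

## References
* [KudlaRallis1994] S. Kudla, S. Rallis, Ann. of Math. 140 (1994): §2 (2.10)–(2.12).
* [MoeglinWaldspurger1995] C. Mœglin, J.-L. Waldspurger, *Spectral decomposition and Eisenstein series* (1995): II.1.7, IV.1.9.
* [Tan1999] V. Tan, Canad. J. Math. 51 (1999): §4 Prop. 4.8.   * [Shimura1997] G. Shimura, CBMS 93 (1997): §18.4 Prop. 18.14.
-/

set_option autoImplicit false
-- the mandated namespace repeats the single-problem summit's segment (`HodgeConjecture.HodgeConjecture`)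
set_option linter.dupNamespace false

noncomputable section

open scoped Matrix ENNReal NNReal Topology ComplexConjugate
open NumberField IsDedekindDomain MeasureTheory MeasureTheory.Measure Filter Set Function
open Literature.NumberTheory.Automorphic Literature.NumberTheory.Automorphic.UnitaryGroup Literature.NumberTheory.GaloisRepresentations
open Literature.NumberTheory.GelbartRogawski1991 Literature.NumberTheory.GelbartRogawski1991.GRConstruction
open Literature.NumberTheory.GelbartRogawski1991.AdaptedBlocks
open Literature.NumberTheory.K2Lit.SiegelDoubled Literature.MeasureTheory.Group
open Literature.NumberTheory.Automorphic.IdeleClassGroup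
open UnitaryDualPair

namespace Summit.HodgeConjecture.HodgeConjecture.Cruxes.HLiu418.K2LiuKindOneLinePin

open K2LiuSiegelUnipotentFourierDefs K2LiuSiegelUnipotentCharacters K2LiuUnipotentCoveringWeight K2LiuSiegelFourierCoeffDelta
open K2LiuSiegelRationalLeviDecomposition K2LiuSiegelMiddleCellSortedPattern K2LiuSiegelMiddleCellLeviCriterion K2LiuSiegelBruhatMiddleCellDelta
open K2LiuRankOneMiddleTermWhittakerLine (exists_middle_cell_rankOne_eq_whittakerDelta_line)
open K2LiuKindOneLineWhittakerHolomorphyCorner (differentiableOn_whittakerDelta_cornerTranslate_line)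
open K2LiuLineCornerChartHaar (isHaarMeasure_map_lineChart)
open K2LiuUnipDeltaConjMeasurePreserving (measurePreserving_conj_levi)
open K2LiuSiegelMiddleTermStabilizerWeight (exists_stabilizer_coveringWeight)
open K2LiuSiegelEisensteinConstantTermFiniteness (lintegral_tsum_enorm_mul_weight_ne_top)

/-- **(P-pin) THE PIN OF THE K1-b♮ LINE TERM AT THE TOP'S FRAME** (corner enumeration `e (1, 0) = 1`).  Socket prefix of #41 at `n = 2` VERBATIM (the standard family
`f` of `I_Δ(s, toHeckeCharacter L lam⁻¹)`, the carrier `(νN, β ≤ 𝟙_K)`, O41.4's `wq`); BY VALUE exactly the objects of the line-term formula: the see-saw datum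
`eA eB dA dB` of `V = A ⊕ B`, the Levi chart `Λ ∕ hΛ`, an additive Haar measure `μ` on `𝔸_{L⁺}` and a continuous additive line chart `nB` of `H(B)` with coordinate
`(t ⊗ 1)δ` (★ p862662), a row section `γ` (★ `exists_rowSection`).  THEN there is ONE constant `C ∈ (0, ∞)` such that for every `T_L`-skew `S = u ⊗ w` (`u, w ≠ 0`) and
every transported index `S'` with `ψ_S(Λĝ⁻¹ v Λĝ) = ψ_{S'}(v)` on `N_Δ(𝔸)` (`ĝ = γ[w]`, ★ `exists_levi_conj_index`):
(hol) `s ↦ (∫β)⁻¹ • (C • W⁽ᴮ⁾_{(σS'σ⁻¹)₂₂}(nB_* μ)(y ↦ f_s(blkD(1,y) · Λĝ · x))(1))` is holomorphic on `{0 < re s}` for every `x` (★ p862749, `p₀ = 1`; `nB_* μ` Haar ★ p862728);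
(pin) for `1 < re s` and every `h`, the TOP's NORMALISED middle-cell term `(∫β)⁻¹ • MID_S(νN, β, f_s, h)` EQUALS that expression at `x = h` (★ p862785 with `g₀` ★
`exists_reflStd`, `Γ₀, β₁` ★ p862779, `hconj` ★ `measurePreserving_conj_levi`, `hH` ★ ed. 4a′, `χ` unitary ★ `isUnitary_toHeckeCharacter`).
[cite: KudlaRallis1994, §2 (2.10)–(2.12)] [cite: MoeglinWaldspurger1995, II.1.7, IV.1.9] [cite: Tan1999, §4 Prop. 4.8] [cite: Shimura1997, §18.4 Prop. 18.14] -/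
theorem exists_pinConst_line
    (L : Type) [Field L] [NumberField L] [IsCMField L] (e : Fin 2 × Fin 1 ≃ Fin 2)
    (dV : Fin 2 → L) (hdV : ∀ i, IsCMField.complexConj L (dV i) = dV i) (hdV0 : ∀ i, dV i ≠ 0)
    (dW : Fin 1 → L) (hdW : ∀ i, IsCMField.complexConj L (dW i) = dW i) (hdW0 : ∀ i, dW i ≠ 0)
    (lam : IdeleClassGroup L →ₜ* Circle) (_hlam : IsConjugateSymplectic L lam) (_hw : HasWeight L lam 1)
    (𝒦 : IwasawaDatum L e dV hdV dW hdW) (_h𝒦 : 𝒦.IsStd) (f : ℂ → HA L e dV hdV dW hdW → ℂ)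
    (hstd : IsStandardSectionFamily 𝒦 (toHeckeCharacter L lam⁻¹) f) (hcont : ∀ s, Continuous (f s))
    [MeasurableSpace (unipDelta L e dV hdV dW hdW)] [BorelSpace (unipDelta L e dV hdV dW hdW)]
    (νN : Measure (unipDelta L e dV hdV dW hdW)) [νN.IsHaarMeasure]
    (β : unipDelta L e dV hdV dW hdW → ℝ≥0∞) (hβ : IsCoveringWeight (unipDeltaRat L e dV hdV dW hdW) β)
    (_hβ0 : ∫⁻ u, β u ∂νN ≠ 0) (hβtop : ∫⁻ u, β u ∂νN ≠ ∞)
    {K : Set (unipDelta L e dV hdV dW hdW)} (hK : IsCompact K) (hβK : ∀ u, β u ≤ K.indicator 1 u)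
    (wq : unipDeltaRat L e dV hdV dW hdW → ratH L e dV hdV dW hdW)
    (hwq : ∀ ν, ((wq ν : ratH L e dV hdV dW hdW) : HA L e dV hdV dW hdW) = weylDelta L e dV hdV dW hdW * ((ν : unipDelta L e dV hdV dW hdW) : HA L e dV hdV dW hdW))
    -- the corner enumeration (the `e (1, 0) = 0` enumeration is the `inl` twin ★ `K2LiuRankOneMiddleTermWhittakerLineInl`)
    (he : e (1, 0) = 1)
    -- the see-saw datum `V = A ⊕ B` BY VALUE (the writer takes `eA = eB` the unique equivalence, `dA _ := dV 0`, `dB _ := dV 1`, `borel` instances)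
    {n₁ n₂ : ℕ} (eA : Fin 1 × Fin 1 ≃ Fin n₁) (eB : Fin 1 × Fin 1 ≃ Fin n₂)
    (dA : Fin 1 → L) (hdA : ∀ i, IsCMField.complexConj L (dA i) = dA i)
    (dB : Fin 1 → L) (hdB : ∀ i, IsCMField.complexConj L (dB i) = dB i) (hdB0 : ∀ i, dB i ≠ 0)
    (hVA : ∀ i, dV (Fin.castAdd 1 i) = dA i) (hVB : ∀ j, dV (Fin.natAdd 1 j) = dB j)
    [MeasurableSpace (unipDelta L eB dB hdB dW hdW)] [BorelSpace (unipDelta L eB dB hdB dW hdW)]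
    -- the Levi chart BY VALUE (★ `exists_leviHom`)
    (Λ : GL (Fin 2) (AdeleRing (𝓞 L) L) →* HA L e dV hdV dW hdW)
    (hΛ : ∀ g : GL (Fin 2) (AdeleRing (𝓞 L) L), blk L e dV hdV dW hdW (Λ g) =
      cayR (AdeleRing (𝓞 L) L) (Fin 2) * Matrix.fromBlocks (g : Matrix (Fin 2) (Fin 2) (AdeleRing (𝓞 L) L)) 0 0
        (((gramR L e dV hdV dW hdW).map ((algebraMap L (AdeleRing (𝓞 L) L)).comp (algebraMap (Fp L) L)))⁻¹ *
          (((g⁻¹ : GL (Fin 2) (AdeleRing (𝓞 L) L)) : Matrix (Fin 2) (Fin 2) (AdeleRing (𝓞 L) L)).map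
            (conjAdele (Fp L) L (IsCMField.complexConj L)))ᵀ *
          (gramR L e dV hdV dW hdW).map ((algebraMap L (AdeleRing (𝓞 L) L)).comp (algebraMap (Fp L) L))) *
        cayRinv (AdeleRing (𝓞 L) L) (Fin 2))
    -- the additive Haar measure on `𝔸_{L⁺}` and the line chart of `H(B)` BY VALUE (★ p862662 `exists_lineChart`)
    [MeasurableSpace (AdeleRing (𝓞 (Fp L)) (Fp L))] [BorelSpace (AdeleRing (𝓞 (Fp L)) (Fp L))]
    (μ : Measure (AdeleRing (𝓞 (Fp L)) (Fp L))) [μ.IsAddHaarMeasure]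
    (nB : AdeleRing (𝓞 (Fp L)) (Fp L) → unipDelta L eB dB hdB dW hdW) (hnBc : Continuous nB) (hnBadd : ∀ s t, nB (s + t) = nB s * nB t)
    (hnB : ∀ t, (blk L eB dB hdB dW hdW (nB t : HA L eB dB hdB dW hdW)).toBlocks₁₂ =
      Matrix.of fun _ _ => AdeleRing.baseChange (Fp L) L t * algebraMap L (AdeleRing (𝓞 L) L) (imagUnit L))
    -- the row section BY VALUE (★ `exists_rowSection`)
    (γ : Projectivization L (Fin 2 → L) → GL (Fin 2) L)
    (hγ : ∀ p, Projectivization.mk L ((γ p : Matrix (Fin 2) (Fin 2) L) 1) (row_ne_zero (γ p) 1) = p) :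
    ∃ C : ℝ≥0∞, C ≠ 0 ∧ C ≠ ∞ ∧
      ∀ (S : skewMatrices ((IsCMField.complexConj L : L ≃ₐ[Fp L] L) : L →+* L) ((gramR L e dV hdV dW hdW).map (algebraMap (Fp L) L)))
        {u w : Fin 2 → L} (_ : (S : Matrix (Fin 2) (Fin 2) L) = Matrix.vecMulVec u w) (_ : u ≠ 0) (hw : w ≠ 0)
        (S' : Matrix (Fin 2) (Fin 2) L)
        (_ : ∀ v : HA L e dV hdV dW hdW, v ∈ unipDelta L e dV hdV dW hdW →
          unipDeltaChar L e dV hdV dW hdW (S : Matrix (Fin 2) (Fin 2) L)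
              ((Λ (Matrix.GeneralLinearGroup.map (algebraMap L (AdeleRing (𝓞 L) L)) (γ (Projectivization.mk L w hw))))⁻¹ * v *
                Λ (Matrix.GeneralLinearGroup.map (algebraMap L (AdeleRing (𝓞 L) L)) (γ (Projectivization.mk L w hw)))) =
            unipDeltaChar L e dV hdV dW hdW S' v),
        -- (hol) the rank-one line term is holomorphic on the WHOLE window, for every `x`
        (∀ x : HA L e dV hdV dW hdW, DifferentiableOn ℂ (fun s : ℂ =>
          ((∫⁻ u, β u ∂νN).toReal⁻¹ : ℝ) •
            (C.toReal • whittakerDelta L eB dB hdB dW hdW (Measure.map nB μ)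
              ((Matrix.reindex (idxSplit e eA eB) (idxSplit e eA eB) S').toBlocks₂₂)
              (fun y => f s (blkD L e eA eB dA hdA dB hdB dV hdV hVA hVB dW hdW (1, y) *
                (Λ (Matrix.GeneralLinearGroup.map (algebraMap L (AdeleRing (𝓞 L) L)) (γ (Projectivization.mk L w hw))) * x))) 1))
          {s : ℂ | 0 < s.re}) ∧
        -- (pin) the TOP's NORMALISED middle-cell term equals it on `{n∕2 < re s}` (`n = 2`; the `hpin` bytes of ★-cand (K1b-♮) ED. 1 :116–:123)
        (∀ (s : ℂ) (h : HA L e dV hdV dW hdW), ((2 : ℕ) : ℝ) / 2 < s.re →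
          ((∫⁻ u, β u ∂νN).toReal⁻¹ : ℝ) •
            (∫ u, (β u).toReal • (conj (unipDeltaChar L e dV hdV dW hdW (S : Matrix (Fin 2) (Fin 2) L) (u : HA L e dV hdV dW hdW) : ℂ) *
              (∑' q : ↥(({Quotient.mk (MulAction.orbitRel (siegelDeltaRat L e dV hdV dW hdW) (ratH L e dV hdV dW hdW)) 1} ∪
                Set.range (fun ν : unipDeltaRat L e dV hdV dW hdW =>
                  (Quotient.mk (MulAction.orbitRel (siegelDeltaRat L e dV hdV dW hdW) (ratH L e dV hdV dW hdW)) (wq ν) :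
                    SiegelDeltaQuot L e dV hdV dW hdW)))ᶜ : Set (SiegelDeltaQuot L e dV hdV dW hdW)),
                f s ((((Quotient.out (q : SiegelDeltaQuot L e dV hdV dW hdW) : ratH L e dV hdV dW hdW) : HA L e dV hdV dW hdW)) *
                  ((u : HA L e dV hdV dW hdW) * h)))) ∂νN) =
          ((∫⁻ u, β u ∂νN).toReal⁻¹ : ℝ) •
            (C.toReal • whittakerDelta L eB dB hdB dW hdW (Measure.map nB μ)
              ((Matrix.reindex (idxSplit e eA eB) (idxSplit e eA eB) S').toBlocks₂₂)
              (fun y => f s (blkD L e eA eB dA hdA dB hdB dV hdV hVA hVB dW hdW (1, y) *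
                (Λ (Matrix.GeneralLinearGroup.map (algebraMap L (AdeleRing (𝓞 L) L)) (γ (Projectivization.mk L w hw))) * h))) 1)) := by
  -- the TOP's character is unitary
  have hχ : (toHeckeCharacter L lam⁻¹).IsUnitary := isUnitary_toHeckeCharacter L lam⁻¹
  -- the line datum has `n₁ = n₂ (= 1)`
  have hn : n₁ = n₂ := by
    have hA : Fintype.card (Fin 1 × Fin 1) = Fintype.card (Fin n₁) := Fintype.card_congr eA
    have hB : Fintype.card (Fin 1 × Fin 1) = Fintype.card (Fin n₂) := Fintype.card_congr eB
    simp only [Fintype.card_prod, Fintype.card_fin] at hA hB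
    omega
  -- the middle reflection `g₀` (★ `exists_reflStd`), the stabiliser lattice `Γ₀` of `w₀ = ι(1, g₀ ⊗ 1)` with a covering weight `β₁` (★ p862779)
  obtain ⟨g₀, hg₀, -⟩ := exists_reflStd L e dV dW
  obtain ⟨Γ₀, β₁, hΓ₀, hβ₁⟩ := exists_stabilizer_coveringWeight L e dV hdV dW hdW
    (⟨iotaGG L e dV hdV dW hdW (1, UnitaryGroup.rationalPairToAdelic (Fp L) L (IsCMField.complexConj L) 2 1 (Matrix.diagonal dV) (Matrix.diagonal dW) g₀),
      iotaGG_one_mem_ratH L e dV hdV dW hdW g₀⟩ : ratH L e dV hdV dW hdW)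
  -- `nB_* μ` is a Haar measure on `N_Δ⁽ᴮ⁾(𝔸)` (★ p862728)
  haveI : (Measure.map nB μ).IsHaarMeasure := isHaarMeasure_map_lineChart L eB dB hdB dW hdW hdB0 hdW0 μ nB hnBc hnBadd hnB
  -- ★ p862785: the constant `C` and the frame identity
  obtain ⟨C, hC0, hCtop, hmain⟩ := exists_middle_cell_rankOne_eq_whittakerDelta_line eA eB dA hdA dB hdB hVA hVB
    (hg₀ := hg₀) (Λ := Λ) (hΛ := hΛ) (Γ₀ := Γ₀) (hΓ₀ := hΓ₀) (wq := wq) (hwq := hwq) hdV0 hdW0 he νN μ nB hnBc hnB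
  refine ⟨C, hC0, hCtop, fun S u w hS1 hu hw S' hψ => ⟨fun x => ?_, fun s h hs => ?_⟩⟩
  · -- (hol): ★ p862749 at `p₀ := 1`, `g := Λĝ · x`, `ν := nB_* μ`
    have hhol := differentiableOn_whittakerDelta_cornerTranslate_line (N₁ := 1) (N₂ := 1) (M := 1) (n := 2) L e eA eB dA hdA dB hdB dV hdV hVA hVB dW hdW
      hdB0 hdW0 hn (𝒦 := 𝒦) (χ := toHeckeCharacter L lam⁻¹) (f := f) hχ hstd hcont (p₀ := 1) (isSiegelDelta_one' L e dV hdV dW hdW)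
      (Λ (Matrix.GeneralLinearGroup.map (algebraMap L (AdeleRing (𝓞 L) L)) (γ (Projectivization.mk L w hw))) * x) (Measure.map nB μ)
      ((Matrix.reindex (idxSplit e eA eB) (idxSplit e eA eB) S').toBlocks₂₂) 1
    simp only [one_mul] at hhol
    exact (hhol.const_smul C.toReal).const_smul ((∫⁻ u, β u ∂νN).toReal⁻¹ : ℝ)
  · -- (pin): ★ p862785 at `f := f s`, `χ := toHeckeCharacter L lam⁻¹`, `hconj` ★ `measurePreserving_conj_levi`, `hH` ★ ed. 4a′
    have hH := lintegral_tsum_enorm_mul_weight_ne_top L e dV hdV dW hdW hdV0 hdW0 hχ hs (hstd.1.1 s) (hcont s) νN hβtop hK hβK h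
    have key := hmain hβ₁ hβ (hstd.1.1 s) (hcont s) (fun g => measurePreserving_conj_levi Λ hΛ hdV0 hdW0 νN g) S.2 hS1 hu hw γ hγ S' hψ h hH
    exact congrArg (fun z : ℂ => ((∫⁻ u, β u ∂νN).toReal⁻¹ : ℝ) • z) key

/-! ## §2 ED. 2 — the `inl` enumeration `e (1, 0) = 0`: the corner is the FIRST summand `V₁ = A`, the chart is `x ↦ blkD (x, 1)` (★ p862771 ∕ ★ `…WhittakerLineInl`) -/

open K2LiuRankOneMiddleTermWhittakerLineInl (exists_middle_cell_rankOne_eq_whittakerDelta_line_inl)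
open K2LiuKindOneLineWhittakerHolomorphy (differentiableOn_whittakerDelta_of_envelope_halfPlane norm_apply_le_add_of_re_mem_Icc)
open K2LiuBlockDiagSectionPullback (isSiegelDeltaSection_family_comp_blkD_inl continuous_comp_blkD_inl)

/-- **THE (hol) LETTER ALONG THE FIRST SUMMAND** (the `blkD (x, 1)`-twin of ★ p862749 `differentiableOn_whittakerDelta_cornerTranslate_line` at `p₀ = 1`): for a
STANDARD family `f` of `I_Δ^{(V)}(·, χ)` (`χ` unitary, continuous members), `g ∈ H(V)(𝔸)`, a Haar measure `ν` on `N_Δ^{(A)}(𝔸)`, an index `μ` and a point `y`, in the LINE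
case `n₁ = n₂` the function `s ↦ W⁽ᴬ⁾_μ(ν)(x ↦ f_s(blkD(x, 1) · g))(y)` is holomorphic on the WHOLE window `{0 < re s}` — ★ (KW1-a)
`differentiableOn_whittakerDelta_of_envelope_halfPlane` on the `A`-datum at shift `c = n₂∕2` with the letters ★ p862495 `isSiegelDeltaSection_family_comp_blkD_inl`,
★ `continuous_comp_blkD_inl`, `hf.1.2` (entire in `s`) and the envelope with constant `1` (★ `norm_apply_le_add_of_re_mem_Icc`).
[cite: KudlaRallis1994, §1–§2] [cite: MoeglinWaldspurger1995, IV.1.9] [cite: Tan1999, §3] -/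
theorem differentiableOn_whittakerDelta_blkD_inl_line
    (L : Type) [Field L] [NumberField L] [IsCMField L]
    {N₁ N₂ M n n₁ n₂ : ℕ} (eV : Fin (N₁ + N₂) × Fin M ≃ Fin n) (eA : Fin N₁ × Fin M ≃ Fin n₁) (eB : Fin N₂ × Fin M ≃ Fin n₂)
    (dA : Fin N₁ → L) (hdA : ∀ i, IsCMField.complexConj L (dA i) = dA i)
    (dB : Fin N₂ → L) (hdB : ∀ i, IsCMField.complexConj L (dB i) = dB i)
    (dV : Fin (N₁ + N₂) → L) (hdV : ∀ i, IsCMField.complexConj L (dV i) = dV i)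
    (hVA : ∀ i, dV (Fin.castAdd N₂ i) = dA i) (hVB : ∀ j, dV (Fin.natAdd N₁ j) = dB j)
    (dW : Fin M → L) (hdW : ∀ i, IsCMField.complexConj L (dW i) = dW i)
    [MeasurableSpace (unipDelta L eA dA hdA dW hdW)] [BorelSpace (unipDelta L eA dA hdA dW hdW)]
    (hdA0 : ∀ i, dA i ≠ 0) (hdW0 : ∀ i, dW i ≠ 0) (hn : n₁ = n₂)
    {𝒦 : IwasawaDatum L eV dV hdV dW hdW} {χ : HeckeCharacter L} (hχ : χ.IsUnitary)
    {f : ℂ → HA L eV dV hdV dW hdW → ℂ} (hf : IsStandardSectionFamily 𝒦 χ f) (hfc : ∀ s, Continuous (f s)) (g : HA L eV dV hdV dW hdW)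
    (ν : Measure (unipDelta L eA dA hdA dW hdW)) [ν.IsHaarMeasure] (μ : Matrix (Fin n₁) (Fin n₁) L) (y : HA L eA dA hdA dW hdW) :
    DifferentiableOn ℂ (fun s => whittakerDelta L eA dA hdA dW hdW ν μ
      (fun x => f s (blkD L eV eA eB dA hdA dB hdB dV hdV hVA hVB dW hdW (x, 1) * g)) y) {s : ℂ | 0 < s.re} := by
  have hcre : (((n₂ : ℂ) / 2).re) = (n₂ : ℝ) / 2 := by simp
  have hc : (n₁ : ℝ) / 2 ≤ ((n₂ : ℂ) / 2).re := by rw [hcre, hn]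
  exact differentiableOn_whittakerDelta_of_envelope_halfPlane L eA dA hdA dW hdW hdA0 hdW0 hχ hc
    (Φ := fun s x => f s (blkD L eV eA eB dA hdA dB hdB dV hdV hVA hVB dW hdW (x, 1) * g))
    (fun s => isSiegelDeltaSection_family_comp_blkD_inl L eV eA eB dA hdA dB hdB dV hdV hVA hVB dW hdW hf.1.1 g s)
    (fun x => (hf.1.2 _).differentiableOn)
    (fun s => continuous_comp_blkD_inl L eV eA eB dA hdA dB hdB dV hdV hVA hVB dW hdW (hfc s) g)
    (fun σ₀ σ₁ _ _ => ⟨1, fun s h₀ h₁ x => by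
      rw [one_mul]
      exact norm_apply_le_add_of_re_mem_Icc hχ hf (by rwa [Complex.ofReal_re]) (by rwa [Complex.ofReal_re]) _⟩) ν μ y

/-- **(P-pin), `inl` ENUMERATION `e (1, 0) = 0`** — the token-for-token twin of `exists_pinConst_line`: the corner of the rank-one files is the FIRST summand
`V₁ = A` (chart `x ↦ blkD (x, 1)`, ★ p862771), so the line chart `nB` and the Haar measure `nB_* μ` live on `N_Δ^{(A)}(𝔸)` (datum `eA dA`), the index is the `₁₁`-block
`(σS'σ⁻¹)₁₁` and the inner section is `y ↦ f_s(blkD(y, 1) · Λĝ · h)`.  ONE constant `C ∈ (0, ∞)` (★ `exists_middle_cell_rankOne_eq_whittakerDelta_line_inl` with `g₀` ★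
`exists_reflStd`, `Γ₀, β₁` ★ p862779, `hconj` ★ `measurePreserving_conj_levi`, `hH` ★ ed. 4a′) such that for every rank-one `S = u ⊗ w` with its transported index `S'`:
(hol) §2 `differentiableOn_whittakerDelta_blkD_inl_line` (for every `x`), and (pin) the TOP's NORMALISED middle-cell term equals
`(∫β)⁻¹ • (C • W⁽ᴬ⁾_{(σS'σ⁻¹)₁₁}(nB_* μ)(y ↦ f_s(blkD(y, 1) · Λĝ · h))(1))` on `{1 < re s}`.
[cite: KudlaRallis1994, §2 (2.10)–(2.12)] [cite: MoeglinWaldspurger1995, II.1.7, IV.1.9] [cite: Tan1999, §4 Prop. 4.8] [cite: Shimura1997, §18.4 Prop. 18.14] -/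
theorem exists_pinConst_line_inl
    (L : Type) [Field L] [NumberField L] [IsCMField L] (e : Fin 2 × Fin 1 ≃ Fin 2)
    (dV : Fin 2 → L) (hdV : ∀ i, IsCMField.complexConj L (dV i) = dV i) (hdV0 : ∀ i, dV i ≠ 0)
    (dW : Fin 1 → L) (hdW : ∀ i, IsCMField.complexConj L (dW i) = dW i) (hdW0 : ∀ i, dW i ≠ 0)
    (lam : IdeleClassGroup L →ₜ* Circle) (_hlam : IsConjugateSymplectic L lam) (_hw : HasWeight L lam 1)
    (𝒦 : IwasawaDatum L e dV hdV dW hdW) (_h𝒦 : 𝒦.IsStd) (f : ℂ → HA L e dV hdV dW hdW → ℂ)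
    (hstd : IsStandardSectionFamily 𝒦 (toHeckeCharacter L lam⁻¹) f) (hcont : ∀ s, Continuous (f s))
    [MeasurableSpace (unipDelta L e dV hdV dW hdW)] [BorelSpace (unipDelta L e dV hdV dW hdW)]
    (νN : Measure (unipDelta L e dV hdV dW hdW)) [νN.IsHaarMeasure]
    (β : unipDelta L e dV hdV dW hdW → ℝ≥0∞) (hβ : IsCoveringWeight (unipDeltaRat L e dV hdV dW hdW) β)
    (_hβ0 : ∫⁻ u, β u ∂νN ≠ 0) (hβtop : ∫⁻ u, β u ∂νN ≠ ∞)
    {K : Set (unipDelta L e dV hdV dW hdW)} (hK : IsCompact K) (hβK : ∀ u, β u ≤ K.indicator 1 u)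
    (wq : unipDeltaRat L e dV hdV dW hdW → ratH L e dV hdV dW hdW)
    (hwq : ∀ ν, ((wq ν : ratH L e dV hdV dW hdW) : HA L e dV hdV dW hdW) = weylDelta L e dV hdV dW hdW * ((ν : unipDelta L e dV hdV dW hdW) : HA L e dV hdV dW hdW))
    -- the `inl` enumeration
    (he : e (1, 0) = 0)
    -- the see-saw datum `V = A ⊕ B` BY VALUE
    {n₁ n₂ : ℕ} (eA : Fin 1 × Fin 1 ≃ Fin n₁) (eB : Fin 1 × Fin 1 ≃ Fin n₂)
    (dA : Fin 1 → L) (hdA : ∀ i, IsCMField.complexConj L (dA i) = dA i) (hdA0 : ∀ i, dA i ≠ 0)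
    (dB : Fin 1 → L) (hdB : ∀ i, IsCMField.complexConj L (dB i) = dB i)
    (hVA : ∀ i, dV (Fin.castAdd 1 i) = dA i) (hVB : ∀ j, dV (Fin.natAdd 1 j) = dB j)
    [MeasurableSpace (unipDelta L eA dA hdA dW hdW)] [BorelSpace (unipDelta L eA dA hdA dW hdW)]
    -- the Levi chart BY VALUE (★ `exists_leviHom`)
    (Λ : GL (Fin 2) (AdeleRing (𝓞 L) L) →* HA L e dV hdV dW hdW)
    (hΛ : ∀ g : GL (Fin 2) (AdeleRing (𝓞 L) L), blk L e dV hdV dW hdW (Λ g) =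
      cayR (AdeleRing (𝓞 L) L) (Fin 2) * Matrix.fromBlocks (g : Matrix (Fin 2) (Fin 2) (AdeleRing (𝓞 L) L)) 0 0
        (((gramR L e dV hdV dW hdW).map ((algebraMap L (AdeleRing (𝓞 L) L)).comp (algebraMap (Fp L) L)))⁻¹ *
          (((g⁻¹ : GL (Fin 2) (AdeleRing (𝓞 L) L)) : Matrix (Fin 2) (Fin 2) (AdeleRing (𝓞 L) L)).map
            (conjAdele (Fp L) L (IsCMField.complexConj L)))ᵀ *
          (gramR L e dV hdV dW hdW).map ((algebraMap L (AdeleRing (𝓞 L) L)).comp (algebraMap (Fp L) L))) *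
        cayRinv (AdeleRing (𝓞 L) L) (Fin 2))
    -- the additive Haar measure on `𝔸_{L⁺}` and the line chart of `H(A)` BY VALUE (★ p862662 `exists_lineChart` on the datum `eA dA`)
    [MeasurableSpace (AdeleRing (𝓞 (Fp L)) (Fp L))] [BorelSpace (AdeleRing (𝓞 (Fp L)) (Fp L))]
    (μ : Measure (AdeleRing (𝓞 (Fp L)) (Fp L))) [μ.IsAddHaarMeasure]
    (nB : AdeleRing (𝓞 (Fp L)) (Fp L) → unipDelta L eA dA hdA dW hdW) (hnBc : Continuous nB) (hnBadd : ∀ s t, nB (s + t) = nB s * nB t)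
    (hnB : ∀ t, (blk L eA dA hdA dW hdW (nB t : HA L eA dA hdA dW hdW)).toBlocks₁₂ =
      Matrix.of fun _ _ => AdeleRing.baseChange (Fp L) L t * algebraMap L (AdeleRing (𝓞 L) L) (imagUnit L))
    -- the row section BY VALUE (★ `exists_rowSection`)
    (γ : Projectivization L (Fin 2 → L) → GL (Fin 2) L)
    (hγ : ∀ p, Projectivization.mk L ((γ p : Matrix (Fin 2) (Fin 2) L) 1) (row_ne_zero (γ p) 1) = p) :
    ∃ C : ℝ≥0∞, C ≠ 0 ∧ C ≠ ∞ ∧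
      ∀ (S : skewMatrices ((IsCMField.complexConj L : L ≃ₐ[Fp L] L) : L →+* L) ((gramR L e dV hdV dW hdW).map (algebraMap (Fp L) L)))
        {u w : Fin 2 → L} (_ : (S : Matrix (Fin 2) (Fin 2) L) = Matrix.vecMulVec u w) (_ : u ≠ 0) (hw : w ≠ 0)
        (S' : Matrix (Fin 2) (Fin 2) L)
        (_ : ∀ v : HA L e dV hdV dW hdW, v ∈ unipDelta L e dV hdV dW hdW →
          unipDeltaChar L e dV hdV dW hdW (S : Matrix (Fin 2) (Fin 2) L)
              ((Λ (Matrix.GeneralLinearGroup.map (algebraMap L (AdeleRing (𝓞 L) L)) (γ (Projectivization.mk L w hw))))⁻¹ * v *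
                Λ (Matrix.GeneralLinearGroup.map (algebraMap L (AdeleRing (𝓞 L) L)) (γ (Projectivization.mk L w hw)))) =
            unipDeltaChar L e dV hdV dW hdW S' v),
        -- (hol) the rank-one line term is holomorphic on the WHOLE window, for every `x`
        (∀ x : HA L e dV hdV dW hdW, DifferentiableOn ℂ (fun s : ℂ =>
          ((∫⁻ u, β u ∂νN).toReal⁻¹ : ℝ) •
            (C.toReal • whittakerDelta L eA dA hdA dW hdW (Measure.map nB μ)
              ((Matrix.reindex (idxSplit e eA eB) (idxSplit e eA eB) S').toBlocks₁₁)
              (fun y => f s (blkD L e eA eB dA hdA dB hdB dV hdV hVA hVB dW hdW (y, 1) *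
                (Λ (Matrix.GeneralLinearGroup.map (algebraMap L (AdeleRing (𝓞 L) L)) (γ (Projectivization.mk L w hw))) * x))) 1))
          {s : ℂ | 0 < s.re}) ∧
        -- (pin) the TOP's NORMALISED middle-cell term equals it on `{n∕2 < re s}` (`n = 2`; the `hpin` bytes of ★ p863141 (K1b-♮) ED. 1)
        (∀ (s : ℂ) (h : HA L e dV hdV dW hdW), ((2 : ℕ) : ℝ) / 2 < s.re →
          ((∫⁻ u, β u ∂νN).toReal⁻¹ : ℝ) •
            (∫ u, (β u).toReal • (conj (unipDeltaChar L e dV hdV dW hdW (S : Matrix (Fin 2) (Fin 2) L) (u : HA L e dV hdV dW hdW) : ℂ) *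
              (∑' q : ↥(({Quotient.mk (MulAction.orbitRel (siegelDeltaRat L e dV hdV dW hdW) (ratH L e dV hdV dW hdW)) 1} ∪
                Set.range (fun ν : unipDeltaRat L e dV hdV dW hdW =>
                  (Quotient.mk (MulAction.orbitRel (siegelDeltaRat L e dV hdV dW hdW) (ratH L e dV hdV dW hdW)) (wq ν) :
                    SiegelDeltaQuot L e dV hdV dW hdW)))ᶜ : Set (SiegelDeltaQuot L e dV hdV dW hdW)),
                f s ((((Quotient.out (q : SiegelDeltaQuot L e dV hdV dW hdW) : ratH L e dV hdV dW hdW) : HA L e dV hdV dW hdW)) *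
                  ((u : HA L e dV hdV dW hdW) * h)))) ∂νN) =
          ((∫⁻ u, β u ∂νN).toReal⁻¹ : ℝ) •
            (C.toReal • whittakerDelta L eA dA hdA dW hdW (Measure.map nB μ)
              ((Matrix.reindex (idxSplit e eA eB) (idxSplit e eA eB) S').toBlocks₁₁)
              (fun y => f s (blkD L e eA eB dA hdA dB hdB dV hdV hVA hVB dW hdW (y, 1) *
                (Λ (Matrix.GeneralLinearGroup.map (algebraMap L (AdeleRing (𝓞 L) L)) (γ (Projectivization.mk L w hw))) * h))) 1)) := by
  -- the TOP's character is unitary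
  have hχ : (toHeckeCharacter L lam⁻¹).IsUnitary := isUnitary_toHeckeCharacter L lam⁻¹
  -- the line datum has `n₁ = n₂ (= 1)`
  have hn : n₁ = n₂ := by
    have hA : Fintype.card (Fin 1 × Fin 1) = Fintype.card (Fin n₁) := Fintype.card_congr eA
    have hB : Fintype.card (Fin 1 × Fin 1) = Fintype.card (Fin n₂) := Fintype.card_congr eB
    simp only [Fintype.card_prod, Fintype.card_fin] at hA hB
    omega
  -- the middle reflection `g₀` (★ `exists_reflStd`), the stabiliser lattice `Γ₀` of `w₀ = ι(1, g₀ ⊗ 1)` with a covering weight `β₁` (★ p862779)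
  obtain ⟨g₀, hg₀, -⟩ := exists_reflStd L e dV dW
  obtain ⟨Γ₀, β₁, hΓ₀, hβ₁⟩ := exists_stabilizer_coveringWeight L e dV hdV dW hdW
    (⟨iotaGG L e dV hdV dW hdW (1, UnitaryGroup.rationalPairToAdelic (Fp L) L (IsCMField.complexConj L) 2 1 (Matrix.diagonal dV) (Matrix.diagonal dW) g₀),
      iotaGG_one_mem_ratH L e dV hdV dW hdW g₀⟩ : ratH L e dV hdV dW hdW)
  -- `nB_* μ` is a Haar measure on `N_Δ⁽ᴬ⁾(𝔸)` (★ p862728 on the datum `eA dA`)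
  haveI : (Measure.map nB μ).IsHaarMeasure := isHaarMeasure_map_lineChart L eA dA hdA dW hdW hdA0 hdW0 μ nB hnBc hnBadd hnB
  -- ★ `…WhittakerLineInl`: the constant `C` and the frame identity along the first summand
  obtain ⟨C, hC0, hCtop, hmain⟩ := exists_middle_cell_rankOne_eq_whittakerDelta_line_inl eA eB dA hdA dB hdB hVA hVB
    (hg₀ := hg₀) (Λ := Λ) (hΛ := hΛ) (Γ₀ := Γ₀) (hΓ₀ := hΓ₀) (wq := wq) (hwq := hwq) hdV0 hdW0 he νN μ nB hnBc hnB
  refine ⟨C, hC0, hCtop, fun S u w hS1 hu hw S' hψ => ⟨fun x => ?_, fun s h hs => ?_⟩⟩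
  · -- (hol): §2 along the first summand, `g := Λĝ · x`, `ν := nB_* μ`
    have hhol := differentiableOn_whittakerDelta_blkD_inl_line (N₁ := 1) (N₂ := 1) (M := 1) (n := 2) L e eA eB dA hdA dB hdB dV hdV hVA hVB dW hdW
      hdA0 hdW0 hn (𝒦 := 𝒦) (χ := toHeckeCharacter L lam⁻¹) (f := f) hχ hstd hcont
      (Λ (Matrix.GeneralLinearGroup.map (algebraMap L (AdeleRing (𝓞 L) L)) (γ (Projectivization.mk L w hw))) * x) (Measure.map nB μ)
      ((Matrix.reindex (idxSplit e eA eB) (idxSplit e eA eB) S').toBlocks₁₁) 1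
    exact (hhol.const_smul C.toReal).const_smul ((∫⁻ u, β u ∂νN).toReal⁻¹ : ℝ)
  · -- (pin): ★ `…WhittakerLineInl` at `f := f s`, `χ := toHeckeCharacter L lam⁻¹`, `hconj` ★ `measurePreserving_conj_levi`, `hH` ★ ed. 4a′
    have hH := lintegral_tsum_enorm_mul_weight_ne_top L e dV hdV dW hdW hdV0 hdW0 hχ hs (hstd.1.1 s) (hcont s) νN hβtop hK hβK h
    have key := hmain hβ₁ hβ (hstd.1.1 s) (hcont s) (fun g => measurePreserving_conj_levi Λ hΛ hdV0 hdW0 νN g) S.2 hS1 hu hw γ hγ S' hψ h hH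
    exact congrArg (fun z : ℂ => ((∫⁻ u, β u ∂νN).toReal⁻¹ : ℝ) • z) key

end Summit.HodgeConjecture.HodgeConjecture.Cruxes.HLiu418.K2LiuKindOneLinePin

end
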